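import Mathlib
import Summits.Ventures.PercRepro.TriangleCapBipStar
import Summits.Ventures.PercRepro.TriangleCapThreeBelowSecondBest

/-!
# PercRepro — THE PAIR IDENTITY: `Σ_v d(v)² + #{ordered pairs of disjoint edges} = m (m + 1)` for EVERY graph, and
the bipartite spectrum of the cherry table — the gap to the closed form IS the disjoint-pair count of the missing
graph (p3, gen 50; part 209)

Every ordered pair of distinct edges either shares a vertex (exactly one, in a simple graph) or is vertex-disjoint.
The pairs sharing the vertex `v` are the ordered pairs of distinct edges at `v`, `d(v)(d(v) − 1)` of them, so
`adjEdgePairs D + Σ_v d(v) = Σ_v d(v)²`; with `adjEdgePairs D + disjEdgePairs D = m (m − 1)` and `Σ_v d(v) = 2 m`: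

  **`Σ_v d(v)² + disjEdgePairs D = m (m + 1)`**   (`sum_deg_sq_add_disjEdgePairs`),

`disjEdgePairs D = 2 ·` the number of unordered pairs of disjoint edges.  The star bound `Σ d² ≤ m (m + 1)` (with
equality iff no two edges are disjoint) is the case `disjEdgePairs = 0`, and on the `a`-bipartite class of the cell
`(k, a, r)` — `D ≤ K(A, Aᶜ)`, `|A| = a`, `m + r = a (k − a)`, missing graph `H` with `r` edges — the identity of
the bipartite sub-problem (`sum_deg_sq_bipSub`) turns it into

  **`Σ_v d_D(v)² + r (k − 1 − r) + disjEdgePairs H = m k`**   (`bipSub_sum_deg_sq_add_disjEdgePairs`):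

the gap of an `a`-bipartite graph to the closed form is EXACTLY `2 ·` the number of disjoint pairs among its
missing cross pairs.  The orders of the cherry table on the bipartite class are the values of that count over the
triangle-free graphs with `r` edges: `0` (a star: the closed form), `2 (r − 2)` (a broom or the `4`-cycle: the
second-best value), `2 (r − 1)` (a star plus a disjoint pair: the third-best value), …

Axioms: standard.
-/

namespace PercRepro

namespace TriangleCap

namespace C047

open Finset

variable {V : Type*} [Fintype V] [DecidableEq V]

/-- The ordered pairs of DISTINCT edges of `D` that share a vertex. -/
def adjEdgePairs (D : SimpleGraph V) [DecidableRel D.Adj] : ℕ :=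
  (D.edgeFinset.offDiag.filter (fun p : Sym2 V × Sym2 V => ∃ v, v ∈ p.1 ∧ v ∈ p.2)).card

/-- The ordered pairs of DISTINCT edges of `D` that are vertex-disjoint (`= 2 ·` the unordered such pairs). -/
def disjEdgePairs (D : SimpleGraph V) [DecidableRel D.Adj] : ℕ :=
  (D.edgeFinset.offDiag.filter (fun p : Sym2 V × Sym2 V => ¬ ∃ v, v ∈ p.1 ∧ v ∈ p.2)).card

/-- The two kinds of ordered pairs of distinct edges partition the `m (m − 1)` of them. -/
theorem adjEdgePairs_add_disjEdgePairs (D : SimpleGraph V) [DecidableRel D.Adj] :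
    adjEdgePairs D + disjEdgePairs D = D.edgeFinset.card * D.edgeFinset.card - D.edgeFinset.card := by
  unfold adjEdgePairs disjEdgePairs
  rw [card_filter_add_card_filter_not, offDiag_card]

omit [Fintype V] [DecidableEq V] in
/-- Two distinct edges of a simple graph share at most one vertex: `v ≠ w` both in `e` and in `f` force
`e = s(v, w) = f`. -/
theorem eq_of_mem_mem_of_ne {e f : Sym2 V} {v w : V} (hvw : v ≠ w) (hve : v ∈ e) (hwe : w ∈ e) (hvf : v ∈ f)
    (hwf : w ∈ f) : e = f := by
  have h1 := (Sym2.mem_and_mem_iff hvw).mp ⟨hve, hwe⟩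
  have h2 := (Sym2.mem_and_mem_iff hvw).mp ⟨hvf, hwf⟩
  rw [h1, h2]

/-- The ordered pairs of distinct edges sharing a vertex are the disjoint union over `v` of the ordered pairs of
distinct edges at `v`. -/
theorem adjEdgePairs_eq_biUnion (D : SimpleGraph V) [DecidableRel D.Adj] :
    D.edgeFinset.offDiag.filter (fun p : Sym2 V × Sym2 V => ∃ v, v ∈ p.1 ∧ v ∈ p.2) =
      univ.biUnion (fun v => (D.incidenceFinset v).offDiag) := by
  ext ⟨e, f⟩
  simp only [mem_filter, mem_offDiag, mem_biUnion, mem_univ, true_and, SimpleGraph.mem_incidenceFinset,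
    SimpleGraph.mem_edgeFinset]
  constructor
  · rintro ⟨⟨he, hf, hne⟩, v, hve, hvf⟩
    exact ⟨v, ⟨he, hve⟩, ⟨hf, hvf⟩, hne⟩
  · rintro ⟨v, ⟨he, hve⟩, ⟨hf, hvf⟩, hne⟩
    exact ⟨⟨he, hf, hne⟩, v, hve, hvf⟩

/-- **THE PAIRS SHARING A VERTEX:** `adjEdgePairs D + Σ_v d(v) = Σ_v d(v)²` (the pairs at `v` number `d(v)(d(v) − 1)`). -/
theorem adjEdgePairs_add_sum_deg (D : SimpleGraph V) [DecidableRel D.Adj] :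
    adjEdgePairs D + ∑ v, deg D v = ∑ v, deg D v * deg D v := by
  unfold adjEdgePairs
  rw [adjEdgePairs_eq_biUnion, card_biUnion, ← sum_add_distrib]
  · apply sum_congr rfl
    intro v _
    rw [offDiag_card, SimpleGraph.card_incidenceFinset_eq_degree, ← deg_eq_degree]
    have := Nat.le_mul_self (deg D v)
    omega
  · intro v _ w _ hvw
    show Disjoint (D.incidenceFinset v).offDiag (D.incidenceFinset w).offDiag
    rw [disjoint_left]
    rintro ⟨e, f⟩ hv hw
    simp only [mem_offDiag, SimpleGraph.mem_incidenceFinset] at hv hw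
    obtain ⟨⟨-, hve⟩, ⟨-, hvf⟩, hne⟩ := hv
    obtain ⟨⟨-, hwe⟩, ⟨-, hwf⟩, -⟩ := hw
    exact hne (eq_of_mem_mem_of_ne hvw hve hwe hvf hwf)

/-- **THE PAIR IDENTITY:** for every graph with `m` edges, `Σ_v d(v)² + disjEdgePairs D = m (m + 1)`. -/
theorem sum_deg_sq_add_disjEdgePairs (D : SimpleGraph V) [DecidableRel D.Adj] :
    ∑ v, deg D v * deg D v + disjEdgePairs D = D.edgeFinset.card * (D.edgeFinset.card + 1) := by
  have h1 := adjEdgePairs_add_disjEdgePairs D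
  have h2 := adjEdgePairs_add_sum_deg D
  have h3 := sum_deg_eq D
  have h4 := Nat.le_mul_self D.edgeFinset.card
  rw [Nat.mul_add, mul_one]
  omega

/-- **THE STAR BOUND:** `Σ_v d(v)² ≤ m (m + 1)` for every graph. -/
theorem sum_deg_sq_le_star (D : SimpleGraph V) [DecidableRel D.Adj] :
    ∑ v, deg D v * deg D v ≤ D.edgeFinset.card * (D.edgeFinset.card + 1) := by
  have := sum_deg_sq_add_disjEdgePairs D
  omega

/-- **THE STAR BOUND IS AN EQUALITY IFF NO TWO EDGES ARE DISJOINT.** -/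
theorem sum_deg_sq_eq_star_iff (D : SimpleGraph V) [DecidableRel D.Adj] :
    ∑ v, deg D v * deg D v = D.edgeFinset.card * (D.edgeFinset.card + 1) ↔ disjEdgePairs D = 0 := by
  have := sum_deg_sq_add_disjEdgePairs D
  omega

/-- **THE BIPARTITE SPECTRUM:** for `D ≤ K(A, Aᶜ)` with `|A| = a`, `m + r = a (k − a)`, `r + 1 ≤ k`, the gap of `D`
to the closed form is the disjoint-pair count of its missing graph:
`Σ_v d(v)² + r (k − 1 − r) + disjEdgePairs (missingGraph D A) = m k`. -/
theorem bipSub_sum_deg_sq_add_disjEdgePairs (D : SimpleGraph V) [DecidableRel D.Adj] (A : Finset V)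
    (hD : BipSub D A) (a r : ℕ) (hA : A.card = a) (hm : D.edgeFinset.card + r = a * (Fintype.card V - a))
    (hk : r + 1 ≤ Fintype.card V) :
    ∑ v, deg D v * deg D v + r * (Fintype.card V - 1 - r) + disjEdgePairs (missingGraph D A) =
      D.edgeFinset.card * Fintype.card V := by
  have h1 := sum_deg_sq_bipSub D A hD
  have h2 := card_edges_missingGraph D A hD a r hA hm
  have h3 := sum_deg_sq_add_disjEdgePairs (missingGraph D A)
  rw [h2, hA] at h1
  rw [h2] at h3
  have ht := closed_form_term_arith (Fintype.card V) r hk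
  have hmk : a * (Fintype.card V - a) * Fintype.card V =
      D.edgeFinset.card * Fintype.card V + r * Fintype.card V := by
    rw [← add_mul, hm]
  rw [hmk] at h1
  rw [Nat.mul_add, mul_one] at h3
  have e : Fintype.card V * r = r * Fintype.card V := Nat.mul_comm _ _
  rw [e] at h1
  omega

/-- **THE BIPARTITE SPECTRUM, GAP FORM:** `m k − (Σ_v d(v)² + r (k − 1 − r)) = disjEdgePairs (missingGraph D A)`. -/
theorem bipSub_gap_eq_disjEdgePairs (D : SimpleGraph V) [DecidableRel D.Adj] (A : Finset V)
    (hD : BipSub D A) (a r : ℕ) (hA : A.card = a) (hm : D.edgeFinset.card + r = a * (Fintype.card V - a))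
    (hk : r + 1 ≤ Fintype.card V) :
    D.edgeFinset.card * Fintype.card V - (∑ v, deg D v * deg D v + r * (Fintype.card V - 1 - r)) =
      disjEdgePairs (missingGraph D A) := by
  have := bipSub_sum_deg_sq_add_disjEdgePairs D A hD a r hA hm hk
  omega

/-- **THE CLOSED FORM ON THE BIPARTITE CLASS IFF NO TWO MISSING PAIRS ARE DISJOINT.** -/
theorem bipSub_closed_form_iff (D : SimpleGraph V) [DecidableRel D.Adj] (A : Finset V)
    (hD : BipSub D A) (a r : ℕ) (hA : A.card = a) (hm : D.edgeFinset.card + r = a * (Fintype.card V - a))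
    (hk : r + 1 ≤ Fintype.card V) :
    ∑ v, deg D v * deg D v + r * (Fintype.card V - 1 - r) = D.edgeFinset.card * Fintype.card V ↔
      disjEdgePairs (missingGraph D A) = 0 := by
  have := bipSub_sum_deg_sq_add_disjEdgePairs D A hD a r hA hm hk
  omega

end C047

end TriangleCap

end PercRepro
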